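import Summits.AtomisticToContinuum.HydrodynamicLimit.Theorems.CollisionIsometryCLTMacroClosureEngineIncrement
import Summits.AtomisticToContinuum.HydrodynamicLimit.Theorems.CollisionIsometryCLTMacroClosureEngineClassical
import Summits.AtomisticToContinuum.HydrodynamicLimit.Theorems.CollisionIsometryCLTMacroClosureEngineBlockClosure
import HarnessLib

/-!
# Sub-goal `engine_incrementIdentity` of the lead's `engine_incrementBound` (line `IdeatorTwoGen1Sketch`,
# crux `MacroClosure`, stmt-AtomisticToContinuum-14870): the sure increment inequality along one trajectory

For a classical hs-Euler solution `(ρ, u, θ)` on `[0, T)` in the dilute chamber of `ThermoChamber η₃`,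
`0 < t < T`, a band floor `c₁ > 0`, there is `Cb ≥ 0` such that for every smooth kernel `φ ≥ 0` of unit
mass supported in `{euclidDist(·, 0) < r}` and every good trajectory `τ ↦ w_τ := Φ_τ z` of a hard-sphere
flow whose blocks stay in the band `c₁ ≤ ρ̄ ≤ σ⁻³` on `[0, t]`, GIVEN the time-integrability on `[0, t]` of
the block production, the classical production, the microscopic production, the collisional closure, the
kinetic defect and the velocity moment `⟨emp w_τ, 1 + |v|³⟩`, the tested observable
`Y(τ) := Obs(τ, w_τ) − ∫ₓ Λ_cl(τ,x)·U_cl(τ,x) dx` satisfies, for every `s ∈ [0, t]`,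

`|Y(s) − Y(0) − ∫_{[0,s]} (prodBlock(τ, w_τ) − prodCl(τ)) dτ| ≤ |ccRes(z, s) − ∫_{[0,s]} ∫ₓ ccClosure|`
`  + Cb r ∫_{[0,t]} ⟨emp w_τ, 1 + |v|³⟩ dτ + Cb (∫_{[0,t]} defect)^{1/2} (t (1 + ⟨emp z, |v|²⟩))^{1/2}`

(with `Y(0)` written at the initial configuration `z`).

Proof. (1) `engine_increment`: `Obs(s, w_s) − Obs(0, z) = ∫_{[0,s]} kinFlux(τ, w_τ) dτ + ccRes(z, s)`.
(2) `engine_classical`: `∫ₓ Λ_s·U_s − ∫ₓ Λ₀·U₀ = ∫_{[0,s]} prodCl`. (3) Hence, splitting and merging the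
time integrals with the given integrabilities (restricted from `[0, t]` to `[0, s]`),
`Y(s) − Y(0) − ∫_{[0,s]} (prodBlock − prodCl) = ∫_{[0,s]} (kinFlux + ∫ₓ ccClosure − prodBlock) dτ +
(ccRes(s) − ∫_{[0,s]} ∫ₓ ccClosure)`. (4) `engine_blockClosure` (its constant `C` is obtained once, before
the kernel and the trajectory) bounds the first integrand at every interior time `τ ∈ (0, s) ⊆ (0, t)` by
`C r ⟨emp w_τ, 1 + |v|³⟩ + C √(defect(τ)) √(1 + ⟨emp w_τ, |v|²⟩)`, and `⟨emp w_τ, |v|²⟩ = ⟨emp z, |v|²⟩`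
by conservation of the kinetic energy along good orbits (`HardSphereFlow.configEnergy_flow`).
(5) Integrate: `|∫ F| ≤ ∫ |F|` (`abs_integral_le_integral_abs`), compare the integrands on the open
window (`integral_Icc_eq_integral_Ioo`, `setIntegral_mono_on`), enlarge the window of the non-negative
moment integral (`setIntegral_mono_set`), and bound `∫_{[0,s]} √defect ≤ √(s ∫_{[0,s]} defect) ≤
√(t ∫_{[0,t]} defect)` by Cauchy–Schwarz (`setIntegral_sqrt_le`, Hölder with `p = q = 2` against the
constant `1`); finally `√(t D) √(1 + e) = √D √(t (1 + e))`. The constant is `Cb = C`.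
-/

noncomputable section

open MeasureTheory Filter Set Topology InformationTheory
open scoped ENNReal ContDiff

namespace Summit.AtomisticToContinuum.HydrodynamicLimit.Theorems.MacroClosureLine

open Literature.MathematicalPhysics.KineticTheory Literature.Analysis.FluidPDE
open Literature.Analysis.FunctionSpaces
open Summit.AtomisticToContinuum.HydrodynamicLimit.Theses

namespace Barycentric

namespace EngineIncrementIdentity

/-- **Cauchy–Schwarz for `√f` on a time window.** For `f ≥ 0` integrable on `[a, b]`, `√f` is
integrable on `[a, b]` and `∫_{[a,b]} √f ≤ √((b − a) ∫_{[a,b]} f)` (Hölder with `p = q = 2` against the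
constant function `1`). -/
theorem setIntegral_sqrt_le {f : ℝ → ℝ} {a b : ℝ} (hab : a ≤ b) (hf : IntegrableOn f (Icc a b))
    (hf0 : ∀ τ ∈ Icc a b, 0 ≤ f τ) :
    IntegrableOn (fun τ => Real.sqrt (f τ)) (Icc a b) ∧
      ∫ τ in Icc a b, Real.sqrt (f τ) ≤ Real.sqrt ((b - a) * ∫ τ in Icc a b, f τ) := by
  have hf0' : ∀ᵐ τ ∂(volume.restrict (Icc a b)), 0 ≤ f τ :=
    (ae_restrict_iff' measurableSet_Icc).2 (ae_of_all _ hf0)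
  have hsm : AEStronglyMeasurable (fun τ => Real.sqrt (f τ)) (volume.restrict (Icc a b)) :=
    Real.continuous_sqrt.comp_aestronglyMeasurable hf.aestronglyMeasurable
  have hL2 : MemLp (fun τ => Real.sqrt (f τ)) 2 (volume.restrict (Icc a b)) := by
    rw [memLp_two_iff_integrable_sq hsm]
    refine hf.congr ?_
    filter_upwards [hf0'] with τ hτ
    rw [Real.sq_sqrt hτ]
  refine ⟨hL2.integrable one_le_two, ?_⟩
  have h := integral_mul_le_Lp_mul_Lq_of_nonneg (μ := volume.restrict (Icc a b))
    Real.HolderConjugate.two_two (ae_of_all _ fun τ => Real.sqrt_nonneg (f τ))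
    (ae_of_all _ fun _ => zero_le_one) (by rw [ENNReal.ofReal_ofNat]; exact hL2) (memLp_const 1)
  have h2 : ∫ τ in Icc a b, Real.sqrt (f τ) ^ (2 : ℝ) = ∫ τ in Icc a b, f τ := by
    refine integral_congr_ae ?_
    filter_upwards [hf0'] with τ hτ
    rw [Real.rpow_two, Real.sq_sqrt hτ]
  have h1 : ∫ _ in Icc a b, (1 : ℝ) ^ (2 : ℝ) = b - a := by
    rw [Real.one_rpow, setIntegral_const, Real.volume_real_Icc_of_le hab, smul_eq_mul, mul_one]
  simp only [mul_one] at h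
  rw [h2, h1] at h
  calc ∫ τ in Icc a b, Real.sqrt (f τ)
      ≤ (∫ τ in Icc a b, f τ) ^ (1 / (2 : ℝ)) * (b - a) ^ (1 / (2 : ℝ)) := h
    _ = (b - a) ^ (1 / (2 : ℝ)) * (∫ τ in Icc a b, f τ) ^ (1 / (2 : ℝ)) := mul_comm _ _
    _ = Real.sqrt ((b - a) * ∫ τ in Icc a b, f τ) := by
      rw [Real.sqrt_eq_rpow, Real.mul_rpow (sub_nonneg.2 hab) (integral_nonneg_of_ae hf0')]

/-- Conservation of the kinetic energy along a good orbit, in the form `⟨emp Φ_τ z, |v|²⟩ = ⟨emp z, |v|²⟩`. -/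
theorem integral_normSq_flow {σ : ℝ} {N : ℕ} (Φ : Flow σ N) {z : Config (N + 1) (Fin 3) T3}
    (hz : z ∈ Φ.good) (τ : ℝ) :
    ∫ y, ‖y.2‖ ^ 2 ∂(empiricalMeasure (Φ.flow τ z)) = ∫ y, ‖y.2‖ ^ 2 ∂(empiricalMeasure z) := by
  have h := Φ.configEnergy_flow hz τ
  simp only [configEnergy] at h
  simp only [integral_empiricalMeasure]
  congr 1
  linarith

end EngineIncrementIdentity

/-! ## The sub-goal -/

/-- **`engine_incrementIdentity` (registered sub-goal S2b of `engine_incrementBound`): the sure increment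
inequality along one good band trajectory.** With `Y(τ) = Obs(τ, w_τ) − ∫ₓ Λ_cl(τ)·U_cl(τ)`, for every
`s ∈ [0, t]`, `|Y(s) − Y(0) − ∫_{[0,s]} (prodBlock − prodCl)| ≤ |ccRes(s) − ∫_{[0,s]} ∫ₓ ccClosure| +
Cb r ∫_{[0,t]} ⟨emp w_τ, 1 + |v|³⟩ + Cb √(∫_{[0,t]} defect) √(t (1 + ⟨emp z, |v|²⟩))`: the pathwise
increment (`engine_increment`), the classical half (`engine_classical`), the block closure
(`engine_blockClosure`) at interior times with the conserved kinetic energy, integrated over `[0, s]`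
with Cauchy–Schwarz for the defect term. -/
theorem engine_incrementIdentity : ∀ (σ : ℝ), 0 < σ → σ < 2⁻¹ →
    StiffCollisionalRelaxation.HsFreeEnergyConvex →
    ∀ (T : ℝ) (ρ θ : ℝ → T3 → ℝ) (u : ℝ → T3 → V3), IsHardSphereEulerSolution σ T ρ u θ →
    ∀ η₃ : ℝ, ThermoChamber η₃ → (∀ s ∈ Ico 0 T, ∀ x, ρ s x * σ ^ 3 < η₃) →
    ∀ t : ℝ, 0 < t → t < T → ∀ c₁ : ℝ, 0 < c₁ → c₁ * σ ^ 3 ≤ 1 →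
    ∃ Cb : ℝ, 0 ≤ Cb ∧ ∀ (N : ℕ) (Φ : Flow σ N) (φ : T3 → ℝ) (r : ℝ), Torus.IsSmooth φ → (∀ y, 0 ≤ φ y) →
      ∫ y, φ y = 1 → (∀ y, r ≤ Torus.euclidDist y 0 → φ y = 0) →
      ∀ z ∈ Φ.good, (∀ τ ∈ Icc 0 t, ∀ x, c₁ ≤ bρ φ (Φ.flow τ z) x ∧ bρ φ (Φ.flow τ z) x * σ ^ 3 ≤ 1) →
      IntegrableOn (fun τ => prodBlock σ T ρ θ u φ τ (Φ.flow τ z)) (Icc 0 t) →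
      IntegrableOn (fun τ => prodCl σ T ρ θ u τ) (Icc 0 t) →
      IntegrableOn (fun τ => kinFlux σ ρ θ u τ (Φ.flow τ z)) (Icc 0 t) →
      IntegrableOn (fun τ => ∫ x, ccClosure σ θ u φ τ (Φ.flow τ z) x) (Icc 0 t) →
      IntegrableOn (fun τ => ∫ x, ((∑ j, ∑ k, bD φ (Φ.flow τ z) x j k ^ 2) + ‖bq φ (Φ.flow τ z) x‖ ^ 2))
        (Icc 0 t) →
      IntegrableOn (fun τ => ∫ y, (1 + ‖y.2‖ ^ 3) ∂(empiricalMeasure (Φ.flow τ z))) (Icc 0 t) →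
      ∀ s ∈ Icc 0 t,
        |(obs σ ρ θ u s (Φ.flow s z) - ∫ x, Lcl σ ρ θ u s x (Ucl ρ θ u s x)) -
            (obs σ ρ θ u 0 z - ∫ x, Lcl σ ρ θ u 0 x (Ucl ρ θ u 0 x)) -
            ∫ τ in Icc 0 s, (prodBlock σ T ρ θ u φ τ (Φ.flow τ z) - prodCl σ T ρ θ u τ)| ≤
          |ccRes θ u Φ z s - ∫ τ in Icc 0 s, ∫ x, ccClosure σ θ u φ τ (Φ.flow τ z) x| +
          Cb * r * (∫ τ in Icc 0 t, ∫ y, (1 + ‖y.2‖ ^ 3) ∂(empiricalMeasure (Φ.flow τ z))) +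
          Cb * Real.sqrt (∫ τ in Icc 0 t, ∫ x, ((∑ j, ∑ k, bD φ (Φ.flow τ z) x j k ^ 2) +
              ‖bq φ (Φ.flow τ z) x‖ ^ 2)) *
            Real.sqrt (t * (1 + ∫ y, ‖y.2‖ ^ 2 ∂(empiricalMeasure z))) := by
  intro σ hσ hσ2 hH T ρ θ u hE η₃ hT hpack t ht htT c₁ hc₁ _hc₁σ
  -- the constant of the block closure, obtained once
  obtain ⟨C, hC0, hC⟩ := engine_blockClosure σ hσ hH T ρ θ u hE η₃ hT hpack t ht htT c₁ hc₁
  refine ⟨C, hC0, ?_⟩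
  intro N Φ φ r hφ hφ0 hφ1 hφr z hz hband hIpb hIpc hIkf hIcc hIdef hIm3 s hs
  -- elementary facts
  have hsub : Icc 0 s ⊆ Icc 0 t := Icc_subset_Icc_right hs.2
  have hr : 0 ≤ r := (ObsCommutator.radius_pos hφ1 hφr).le
  have hM3nn : ∀ τ, 0 ≤ ∫ y, (1 + ‖y.2‖ ^ 3) ∂(empiricalMeasure (Φ.flow τ z)) :=
    fun τ => integral_nonneg fun y => by positivity
  have hdef0 : ∀ τ, 0 ≤ ∫ x, ((∑ j, ∑ k, bD φ (Φ.flow τ z) x j k ^ 2) + ‖bq φ (Φ.flow τ z) x‖ ^ 2) :=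
    fun τ => integral_nonneg fun x => by positivity
  have he2nn : 0 ≤ ∫ y, ‖y.2‖ ^ 2 ∂(empiricalMeasure z) := integral_nonneg fun y => by positivity
  -- (1), (2): the two landed identities
  have h1 := engine_increment σ hσ hσ2 T ρ θ u hE η₃ hT hpack t ht htT N Φ z hz s hs
  have h2 := engine_classical σ hσ T ρ θ u hE η₃ hT hpack s hs.1 (hs.2.trans_lt htT)
  -- (3): integrability on `[0, s]`, splitting and merging of the time integrals
  have hIpb' := hIpb.mono_set hsub
  have hIpc' := hIpc.mono_set hsub
  have hIkf' := hIkf.mono_set hsub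
  have hIcc' := hIcc.mono_set hsub
  have hIdef' := hIdef.mono_set hsub
  have hIm3' := hIm3.mono_set hsub
  have hsplit : ∫ τ in Icc 0 s, (prodBlock σ T ρ θ u φ τ (Φ.flow τ z) - prodCl σ T ρ θ u τ) =
      (∫ τ in Icc 0 s, prodBlock σ T ρ θ u φ τ (Φ.flow τ z)) - ∫ τ in Icc 0 s, prodCl σ T ρ θ u τ :=
    integral_sub hIpb' hIpc'
  have hF : ∫ τ in Icc 0 s, (kinFlux σ ρ θ u τ (Φ.flow τ z) +
      (∫ x, ccClosure σ θ u φ τ (Φ.flow τ z) x) - prodBlock σ T ρ θ u φ τ (Φ.flow τ z)) =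
      (∫ τ in Icc 0 s, kinFlux σ ρ θ u τ (Φ.flow τ z)) +
        (∫ τ in Icc 0 s, ∫ x, ccClosure σ θ u φ τ (Φ.flow τ z) x) -
        ∫ τ in Icc 0 s, prodBlock σ T ρ θ u φ τ (Φ.flow τ z) := by
    have hI2 : IntegrableOn (fun τ => kinFlux σ ρ θ u τ (Φ.flow τ z) +
        ∫ x, ccClosure σ θ u φ τ (Φ.flow τ z) x) (Icc 0 s) := hIkf'.add hIcc'
    rw [integral_sub hI2 hIpb', integral_add hIkf' hIcc']
  have hkey : (obs σ ρ θ u s (Φ.flow s z) - ∫ x, Lcl σ ρ θ u s x (Ucl ρ θ u s x)) -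
      (obs σ ρ θ u 0 z - ∫ x, Lcl σ ρ θ u 0 x (Ucl ρ θ u 0 x)) -
      ∫ τ in Icc 0 s, (prodBlock σ T ρ θ u φ τ (Φ.flow τ z) - prodCl σ T ρ θ u τ) =
      (∫ τ in Icc 0 s, (kinFlux σ ρ θ u τ (Φ.flow τ z) +
        (∫ x, ccClosure σ θ u φ τ (Φ.flow τ z) x) - prodBlock σ T ρ θ u φ τ (Φ.flow τ z))) +
      (ccRes θ u Φ z s - ∫ τ in Icc 0 s, ∫ x, ccClosure σ θ u φ τ (Φ.flow τ z) x) := by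
    rw [hsplit, hF]
    linarith [h1, h2]
  -- (4): the block closure at interior times, with the conserved kinetic energy
  have hpt : ∀ τ ∈ Ioo 0 s, |kinFlux σ ρ θ u τ (Φ.flow τ z) +
      (∫ x, ccClosure σ θ u φ τ (Φ.flow τ z) x) - prodBlock σ T ρ θ u φ τ (Φ.flow τ z)| ≤
      C * r * (∫ y, (1 + ‖y.2‖ ^ 3) ∂(empiricalMeasure (Φ.flow τ z))) +
        C * Real.sqrt (∫ x, ((∑ j, ∑ k, bD φ (Φ.flow τ z) x j k ^ 2) + ‖bq φ (Φ.flow τ z) x‖ ^ 2)) *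
          Real.sqrt (1 + ∫ y, ‖y.2‖ ^ 2 ∂(empiricalMeasure z)) := by
    intro τ hτ
    have h := hC N φ r hφ hφ0 hφ1 hφr (Φ.flow τ z) (hband τ ⟨hτ.1.le, hτ.2.le.trans hs.2⟩) τ
      ⟨hτ.1, hτ.2.trans_le hs.2⟩
    rwa [EngineIncrementIdentity.integral_normSq_flow Φ hz τ] at h
  -- (5): integrate the bound over `[0, s]`
  obtain ⟨hIsq, hCS⟩ :=
    EngineIncrementIdentity.setIntegral_sqrt_le hs.1 hIdef' fun τ _ => hdef0 τ
  have hFi : IntegrableOn (fun τ => kinFlux σ ρ θ u τ (Φ.flow τ z) +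
      (∫ x, ccClosure σ θ u φ τ (Φ.flow τ z) x) - prodBlock σ T ρ θ u φ τ (Φ.flow τ z)) (Icc 0 s) :=
    (hIkf'.add hIcc').sub hIpb'
  have hBi : IntegrableOn (fun τ => C * r * (∫ y, (1 + ‖y.2‖ ^ 3) ∂(empiricalMeasure (Φ.flow τ z))) +
      C * Real.sqrt (∫ x, ((∑ j, ∑ k, bD φ (Φ.flow τ z) x j k ^ 2) + ‖bq φ (Φ.flow τ z) x‖ ^ 2)) *
        Real.sqrt (1 + ∫ y, ‖y.2‖ ^ 2 ∂(empiricalMeasure z))) (Icc 0 s) :=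
    (hIm3'.const_mul (C * r)).add ((hIsq.const_mul C).mul_const _)
  have hmono : ∫ τ in Icc 0 s, |kinFlux σ ρ θ u τ (Φ.flow τ z) +
      (∫ x, ccClosure σ θ u φ τ (Φ.flow τ z) x) - prodBlock σ T ρ θ u φ τ (Φ.flow τ z)| ≤
      ∫ τ in Icc 0 s, (C * r * (∫ y, (1 + ‖y.2‖ ^ 3) ∂(empiricalMeasure (Φ.flow τ z))) +
        C * Real.sqrt (∫ x, ((∑ j, ∑ k, bD φ (Φ.flow τ z) x j k ^ 2) + ‖bq φ (Φ.flow τ z) x‖ ^ 2)) *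
          Real.sqrt (1 + ∫ y, ‖y.2‖ ^ 2 ∂(empiricalMeasure z))) := by
    rw [integral_Icc_eq_integral_Ioo, integral_Icc_eq_integral_Ioo]
    exact setIntegral_mono_on (IntegrableOn.mono_set hFi.abs Ioo_subset_Icc_self)
      (hBi.mono_set Ioo_subset_Icc_self) measurableSet_Ioo hpt
  have hInt : ∫ τ in Icc 0 s, (C * r * (∫ y, (1 + ‖y.2‖ ^ 3) ∂(empiricalMeasure (Φ.flow τ z))) +
        C * Real.sqrt (∫ x, ((∑ j, ∑ k, bD φ (Φ.flow τ z) x j k ^ 2) + ‖bq φ (Φ.flow τ z) x‖ ^ 2)) *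
          Real.sqrt (1 + ∫ y, ‖y.2‖ ^ 2 ∂(empiricalMeasure z))) =
      C * r * (∫ τ in Icc 0 s, ∫ y, (1 + ‖y.2‖ ^ 3) ∂(empiricalMeasure (Φ.flow τ z))) +
        C * (∫ τ in Icc 0 s, Real.sqrt (∫ x, ((∑ j, ∑ k, bD φ (Φ.flow τ z) x j k ^ 2) +
          ‖bq φ (Φ.flow τ z) x‖ ^ 2))) * Real.sqrt (1 + ∫ y, ‖y.2‖ ^ 2 ∂(empiricalMeasure z)) := by
    rw [integral_add (hIm3'.const_mul (C * r)) ((hIsq.const_mul C).mul_const _), integral_const_mul,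
      integral_mul_const, integral_const_mul]
  -- (6): enlarge the window, Cauchy–Schwarz for the defect term
  have hM3mono : ∫ τ in Icc 0 s, ∫ y, (1 + ‖y.2‖ ^ 3) ∂(empiricalMeasure (Φ.flow τ z)) ≤
      ∫ τ in Icc 0 t, ∫ y, (1 + ‖y.2‖ ^ 3) ∂(empiricalMeasure (Φ.flow τ z)) :=
    setIntegral_mono_set hIm3 (ae_of_all _ fun τ => hM3nn τ) hsub.eventuallyLE
  have hdefmono : ∫ τ in Icc 0 s, ∫ x, ((∑ j, ∑ k, bD φ (Φ.flow τ z) x j k ^ 2) +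
      ‖bq φ (Φ.flow τ z) x‖ ^ 2) ≤
      ∫ τ in Icc 0 t, ∫ x, ((∑ j, ∑ k, bD φ (Φ.flow τ z) x j k ^ 2) + ‖bq φ (Φ.flow τ z) x‖ ^ 2) :=
    setIntegral_mono_set hIdef (ae_of_all _ fun τ => hdef0 τ) hsub.eventuallyLE
  have h3 : ∫ τ in Icc 0 s, Real.sqrt (∫ x, ((∑ j, ∑ k, bD φ (Φ.flow τ z) x j k ^ 2) +
      ‖bq φ (Φ.flow τ z) x‖ ^ 2)) ≤
      Real.sqrt (t * ∫ τ in Icc 0 t, ∫ x, ((∑ j, ∑ k, bD φ (Φ.flow τ z) x j k ^ 2) +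
        ‖bq φ (Φ.flow τ z) x‖ ^ 2)) := by
    refine hCS.trans (Real.sqrt_le_sqrt ?_)
    rw [sub_zero]
    exact mul_le_mul hs.2 hdefmono (setIntegral_nonneg measurableSet_Icc fun τ _ => hdef0 τ) ht.le
  have hsqrt : (∫ τ in Icc 0 s, Real.sqrt (∫ x, ((∑ j, ∑ k, bD φ (Φ.flow τ z) x j k ^ 2) +
      ‖bq φ (Φ.flow τ z) x‖ ^ 2))) * Real.sqrt (1 + ∫ y, ‖y.2‖ ^ 2 ∂(empiricalMeasure z)) ≤
      Real.sqrt (∫ τ in Icc 0 t, ∫ x, ((∑ j, ∑ k, bD φ (Φ.flow τ z) x j k ^ 2) +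
        ‖bq φ (Φ.flow τ z) x‖ ^ 2)) * Real.sqrt (t * (1 + ∫ y, ‖y.2‖ ^ 2 ∂(empiricalMeasure z))) :=
    calc (∫ τ in Icc 0 s, Real.sqrt (∫ x, ((∑ j, ∑ k, bD φ (Φ.flow τ z) x j k ^ 2) +
          ‖bq φ (Φ.flow τ z) x‖ ^ 2))) * Real.sqrt (1 + ∫ y, ‖y.2‖ ^ 2 ∂(empiricalMeasure z))
        ≤ Real.sqrt (t * ∫ τ in Icc 0 t, ∫ x, ((∑ j, ∑ k, bD φ (Φ.flow τ z) x j k ^ 2) +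
            ‖bq φ (Φ.flow τ z) x‖ ^ 2)) * Real.sqrt (1 + ∫ y, ‖y.2‖ ^ 2 ∂(empiricalMeasure z)) :=
          mul_le_mul_of_nonneg_right h3 (Real.sqrt_nonneg _)
      _ = Real.sqrt (∫ τ in Icc 0 t, ∫ x, ((∑ j, ∑ k, bD φ (Φ.flow τ z) x j k ^ 2) +
            ‖bq φ (Φ.flow τ z) x‖ ^ 2)) * Real.sqrt (t * (1 + ∫ y, ‖y.2‖ ^ 2 ∂(empiricalMeasure z))) := by
          rw [Real.sqrt_mul ht.le, Real.sqrt_mul ht.le]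
          ring
  -- assembly
  have hIF := (abs_integral_le_integral_abs).trans hmono
  have hA := mul_le_mul_of_nonneg_left hM3mono (mul_nonneg hC0 hr)
  have hB := mul_le_mul_of_nonneg_left hsqrt hC0
  rw [hkey]
  calc _ ≤ |∫ τ in Icc 0 s, (kinFlux σ ρ θ u τ (Φ.flow τ z) +
          (∫ x, ccClosure σ θ u φ τ (Φ.flow τ z) x) - prodBlock σ T ρ θ u φ τ (Φ.flow τ z))| +
        |ccRes θ u Φ z s - ∫ τ in Icc 0 s, ∫ x, ccClosure σ θ u φ τ (Φ.flow τ z) x| :=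
        abs_add_le _ _
    _ ≤ _ := by linarith [hIF, hInt, hA, hB, he2nn]

end Barycentric

end Summit.AtomisticToContinuum.HydrodynamicLimit.Theorems.MacroClosureLine

end
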